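import Summits.CriticalPhenomena.PercolationContinuityZ3.Theorems.PercNearOneGluingNoHeavyLowerTailStarSetEarlyBound
import HarnessLib

/-!
# `NoHeavyLowerTail` (stmt-CriticalPhenomena-4575) — the UNIT BOUND of LEAN-BLUEPRINT-U1.md §C from the early bound and the residual bound

Support file (prover `prim-gen-swap` gen 15; `--supports stmt-CriticalPhenomena-4575`).  No definitions, no named facts, no sorries.

The unit bound (`UnitBound.TARGET` of the cell, blueprint §C/§G) says that the charged units `(S, X)` of the configuration expansion are paid
by the credit configurations plus the class-word budget `Σ_T C_T`.  Gen 14's `StarSet.early_bound` pays the units of the three EARLY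
families (A0 / regular / swap) with the non-pool credits and `51/128` of the r-free triangle words, `1/2` of the regular-triple words.
This file is the LEDGER (U1-PROOF.md §9): it fixes the statement of the RESIDUAL BOUND — the units that are in none of the three early
families are paid by the POOL credits (credit configurations all of whose classes pass through `r`), the class-words of the class-sets
that are neither r-free triangles nor regular triples, and `13/128` of the regular-triple words — and proves that early bound + residual
bound give the unit bound for every free rule choosing an Ω-chord, through `q₀ = P I₀` when one passes through it (the TARGET's rule does):
per class-set the coefficients add up to at most `1` (`51/128 + 1/2 + 13/128 = 1` on triangles that are regular triples).  The left side is
literally the hypothesis `hU` of `StarSet.charging_classLevel_of_units` (p216096) with `B = Σ_T C_T`.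

* `StarSet.unit_bound_of_residual` — the unit bound, given the residual bound as the hypothesis `hR` (to be discharged by
  `StarSet.residual_bound`, blueprint §G4).
-/

namespace Summit.CriticalPhenomena.PercolationContinuityZ3.Theorems

open Finset
open scoped BigOperators Classical

namespace StarSet

variable {ι V : Type*} [Fintype ι] [LinearOrder ι] [DecidableEq V]

/-- **The unit bound from the residual bound (ledger, U1-PROOF.md §9).**  `hR` is the residual bound: for every finite set `U` of charged
units `(S, X)` (`X ∈ Ω S`, and `X ≠ free S` when `y(S) = 1`) that are in none of the three early families (no r-free triangle in `S`, no
regular partner, no admissible swap port), `Σ_U W(S) ≤ Σ_{cred S, S ⊆ Pool} W(S) + Σ_{T ∉ TRIS ∪ REGT} C_T + (13/128) Σ_{T ∈ REGT} C_T`, for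
any weight/capacity/Ω/credit functions satisfying their defining equations, any free rule choosing an Ω-chord, through `q₀` when possible, and
any sets `TRIS` = the r-free triangles, `REGT` = the regular triples. -/
theorem unit_bound_of_residual [Fintype V] (P P' : ι → V) (hPP' : ∀ X, P X ≠ P' X)
    (hinj : Function.Injective fun X => (s(P X, P' X) : Sym2 V)) (r : V) (F : Finset ι)
    (hforest : ∀ K ∈ F, ∀ I ∈ F, K < I → P' K ≠ P I ∧ P' K ≠ P' I)
    (θ : ι → ℝ) (hθ0 : ∀ X, 0 ≤ θ X) (hθ1 : ∀ X, θ X < 1)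
    (O : ι → V → ℝ) (hO0 : ∀ X d, 0 ≤ O X d) (Φ : ι → ℝ)
    (hO2 : ∀ X, Φ X ^ 2 ≤ O X (P X) * O X (P' X))
    (hΦ4 : ∀ X, 4 * θ X ≤ Φ X) (hΦsq : ∀ X, θ X ≤ Φ X ^ 2)
    (dom : ι → V → ι)
    (hdom : ∀ X ∉ F, ∀ d, (P X = d ∨ P' X = d) →
      dom X d ∈ F ∧ (P (dom X d) = d ∨ P' (dom X d) = d) ∧
        (∀ u, (P (dom X d) = u ∨ P' (dom X d) = u) → (P X = u ∨ P' X = u) → u = d) ∧ θ X ≤ θ (dom X d))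
    (free : Finset ι → ι)
    (hfree : ∀ S : Finset ι, (S.filter (fun X => X ∈ (univ \ F).filter (fun κ => P κ ≠ r ∧ P' κ ≠ r) ∧
      ∀ Y ∈ S, (P Y = P X ∨ P Y = P' X ∨ P' Y = P X ∨ P' Y = P' X))).Nonempty →
      free S ∈ S.filter (fun X => X ∈ (univ \ F).filter (fun κ => P κ ≠ r ∧ P' κ ≠ r) ∧
        ∀ Y ∈ S, (P Y = P X ∨ P Y = P' X ∨ P' Y = P X ∨ P' Y = P' X)))
    (hfreeq : ∀ S : Finset ι, (∃ X ∈ S.filter (fun X => X ∈ (univ \ F).filter (fun κ => P κ ≠ r ∧ P' κ ≠ r) ∧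
        ∀ Y ∈ S, (P Y = P X ∨ P Y = P' X ∨ P' Y = P X ∨ P' Y = P' X)), ∃ I ∈ F, P' I = r ∧ (P X = P I ∨ P' X = P I)) →
      ∃ I ∈ F, P' I = r ∧ (P (free S) = P I ∨ P' (free S) = P I))
    (hR : ∀ (W : Finset ι → ℝ) (_ : ∀ S, W S = (∏ k ∈ S, θ k) * ∏ k ∈ univ \ S, (1 - θ k))
      (C : Finset ι → ℝ) (_ : ∀ T, C T = ∑ δ ∈ (univ : Finset (ι → Bool)).filter (fun δ => (∀ K ∉ T, δ K = false) ∧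
          3 ≤ (T.image fun K => if δ K then P K else P' K).card ∧ r ∉ T.image fun K => if δ K then P K else P' K),
        ∏ K ∈ T, O K (if δ K then P K else P' K))
      (Ω : Finset ι → Finset ι) (_ : ∀ S, Ω S = S.filter (fun X => X ∈ (univ \ F).filter (fun κ => P κ ≠ r ∧ P' κ ≠ r) ∧
          ∀ Y ∈ S, (P Y = P X ∨ P Y = P' X ∨ P' Y = P X ∨ P' Y = P' X)))
      (cred : Finset ι → Prop) (_ : ∀ S, cred S ↔ Ω S = ∅ ∧
        ((∀ I ∈ F, I ∉ S) ∨ ∃ a ∈ F, P a = r ∧ a ∈ S ∧ ∀ b ∈ F, b < a → b ∉ S))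
      (free : Finset ι → ι) (_ : ∀ S, (Ω S).Nonempty → free S ∈ Ω S)
      (_ : ∀ S, (∃ X ∈ Ω S, ∃ I ∈ F, P' I = r ∧ (P X = P I ∨ P' X = P I)) →
        ∃ I ∈ F, P' I = r ∧ (P (free S) = P I ∨ P' (free S) = P I))
      (TRIS : Finset (Finset ι))
      (_ : ∀ T, T ∈ TRIS ↔ ∃ (a b c : V) (X Y Z : ι), a ≠ b ∧ a ≠ c ∧ b ≠ c ∧ a ≠ r ∧ b ≠ r ∧ c ≠ r ∧
        (s(P X, P' X) : Sym2 V) = s(a, b) ∧ (s(P Y, P' Y) : Sym2 V) = s(a, c) ∧ (s(P Z, P' Z) : Sym2 V) = s(b, c) ∧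
        T = {X, Y, Z})
      (REGT : Finset (Finset ι))
      (_ : ∀ T, T ∈ REGT ↔ ∃ (M E₁ E₂ : ι) (q₁ q₂ f₁ f₂ : V),
          M ∉ F ∧ (s(P M, P' M) : Sym2 V) = s(q₁, q₂) ∧ (s(P E₁, P' E₁) : Sym2 V) = s(q₁, f₁) ∧
          (s(P E₂, P' E₂) : Sym2 V) = s(q₂, f₂) ∧ q₁ ≠ q₂ ∧ f₁ ≠ q₁ ∧ f₁ ≠ q₂ ∧ f₂ ≠ q₁ ∧ f₂ ≠ q₂ ∧
          q₁ ≠ r ∧ q₂ ≠ r ∧ f₁ ≠ r ∧ f₂ ≠ r ∧ T = {M, E₁, E₂})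
      (U : Finset (Finset ι × ι))
      (_ : ∀ u ∈ U, u.2 ∈ Ω u.1 ∧
        (((∀ I ∈ F, I ∉ u.1) ∨ ∃ a ∈ F, P a = r ∧ a ∈ u.1 ∧ ∀ b ∈ F, b < a → b ∉ u.1) → u.2 ≠ free u.1) ∧
        ¬ (∃ a b c : V, a ≠ b ∧ a ≠ c ∧ b ≠ c ∧ a ≠ r ∧ b ≠ r ∧ c ≠ r ∧
            (∃ X ∈ u.1, (s(P X, P' X) : Sym2 V) = s(a, b)) ∧ (∃ Y ∈ u.1, (s(P Y, P' Y) : Sym2 V) = s(a, c)) ∧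
              ∃ Z ∈ u.1, (s(P Z, P' Z) : Sym2 V) = s(b, c)) ∧
        ¬ (∃ Y ∈ u.1, Y ≠ u.2 ∧ P Y ≠ r ∧ P' Y ≠ r ∧
            ((∃ p, (P u.2 = p ∨ P' u.2 = p) ∧ P Y ≠ p ∧ P' Y ≠ p ∧ P (dom u.2 p) ≠ r ∧ P' (dom u.2 p) ≠ r) ∨
             (Y ∉ F ∧ ∃ s', (P Y = s' ∨ P' Y = s') ∧ P u.2 ≠ s' ∧ P' u.2 ≠ s' ∧ P (dom Y s') ≠ r ∧ P' (dom Y s') ≠ r))) ∧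
        ¬ (∃ d, (P u.2 = d ∨ P' u.2 = d) ∧ P (dom u.2 d) = r ∧ (∃ Y ∈ u.1, P Y ≠ d ∧ P' Y ≠ d) ∧
            cred (insert (dom u.2 d) (u.1.erase u.2)))),
      ∑ u ∈ U, W u.1 ≤
        ∑ S ∈ (univ : Finset ι).powerset.filter (fun S => cred S ∧
            ∀ K ∈ S, (K ∉ F ∧ (P K = r ∨ P' K = r)) ∨ (K ∈ F ∧ P K = r)), W S +
          ∑ T ∈ (univ : Finset ι).powerset.filter (fun T => T ∉ TRIS ∧ T ∉ REGT), C T + (13 / 128) * ∑ T ∈ REGT, C T) :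
    ∑ u ∈ (univ : Finset (Finset ι × ι)).filter (fun u => u.2 ∈
        (if ((∀ I ∈ F, I ∉ u.1) ∨ ∃ a ∈ F, P a = r ∧ a ∈ u.1 ∧ ∀ b ∈ F, b < a → b ∉ u.1) then
          (u.1.filter (fun X => X ∈ (univ \ F).filter (fun κ => P κ ≠ r ∧ P' κ ≠ r) ∧
            ∀ Y ∈ u.1, (P Y = P X ∨ P Y = P' X ∨ P' Y = P X ∨ P' Y = P' X))).erase (free u.1)
         else
          u.1.filter (fun X => X ∈ (univ \ F).filter (fun κ => P κ ≠ r ∧ P' κ ≠ r) ∧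
            ∀ Y ∈ u.1, (P Y = P X ∨ P Y = P' X ∨ P' Y = P X ∨ P' Y = P' X)))),
        ((∏ k ∈ u.1, θ k) * ∏ k ∈ univ \ u.1, (1 - θ k)) ≤
      ∑ S ∈ (univ : Finset ι).powerset.filter (fun S =>
          S.filter (fun X => X ∈ (univ \ F).filter (fun κ => P κ ≠ r ∧ P' κ ≠ r) ∧
            ∀ Y ∈ S, (P Y = P X ∨ P Y = P' X ∨ P' Y = P X ∨ P' Y = P' X)) = ∅ ∧
          ((∀ I ∈ F, I ∉ S) ∨ ∃ a ∈ F, P a = r ∧ a ∈ S ∧ ∀ b ∈ F, b < a → b ∉ S)),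
        ((∏ k ∈ S, θ k) * ∏ k ∈ univ \ S, (1 - θ k)) +
      ∑ T ∈ (univ : Finset ι).powerset,
        ∑ δ ∈ (univ : Finset (ι → Bool)).filter (fun δ => (∀ X ∉ T, δ X = false) ∧
            3 ≤ (T.image fun X => if δ X then P X else P' X).card ∧ r ∉ T.image fun X => if δ X then P X else P' X),
          ∏ X ∈ T, O X (if δ X then P X else P' X) := by
  -- names for the inline objects
  set W : Finset ι → ℝ := fun S => (∏ k ∈ S, θ k) * ∏ k ∈ univ \ S, (1 - θ k) with hW
  set C : Finset ι → ℝ := fun T => ∑ δ ∈ (univ : Finset (ι → Bool)).filter (fun δ => (∀ X ∉ T, δ X = false) ∧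
      3 ≤ (T.image fun X => if δ X then P X else P' X).card ∧ r ∉ T.image fun X => if δ X then P X else P' X),
    ∏ X ∈ T, O X (if δ X then P X else P' X) with hC
  set Ω : Finset ι → Finset ι := fun S => S.filter (fun X => X ∈ (univ \ F).filter (fun κ => P κ ≠ r ∧ P' κ ≠ r) ∧
      ∀ Y ∈ S, (P Y = P X ∨ P Y = P' X ∨ P' Y = P X ∨ P' Y = P' X)) with hΩ
  set y1 : Finset ι → Prop := fun S => (∀ I ∈ F, I ∉ S) ∨ ∃ a ∈ F, P a = r ∧ a ∈ S ∧ ∀ b ∈ F, b < a → b ∉ S with hy1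
  set cred : Finset ι → Prop := fun S => Ω S = ∅ ∧ y1 S with hcred
  have hfree' : ∀ S, (Ω S).Nonempty → free S ∈ Ω S := fun S h => hfree S h
  have hfreeq' : ∀ S, (∃ X ∈ Ω S, ∃ I ∈ F, P' I = r ∧ (P X = P I ∨ P' X = P I)) →
      ∃ I ∈ F, P' I = r ∧ (P (free S) = P I ∨ P' (free S) = P I) := fun S h => hfreeq S h
  have hθ1' : ∀ X, θ X ≤ 1 := fun X => (hθ1 X).le
  have hW0 : ∀ S, 0 ≤ W S := fun S =>
    mul_nonneg (prod_nonneg fun k _ => hθ0 k) (prod_nonneg fun k _ => sub_nonneg.2 (hθ1' k))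
  have hC0 : ∀ T, 0 ≤ C T := fun T => sum_nonneg fun δ _ => prod_nonneg fun K _ => hO0 _ _
  -- the pool predicate and the two shape predicates, with classical decidability (no `Fintype V`-based instances)
  set pool : ι → Prop := fun K => (K ∉ F ∧ (P K = r ∨ P' K = r)) ∨ (K ∈ F ∧ P K = r) with hpool
  set tri : Finset ι → Prop := fun T => ∃ (a b c : V) (X Y Z : ι), a ≠ b ∧ a ≠ c ∧ b ≠ c ∧ a ≠ r ∧ b ≠ r ∧ c ≠ r ∧
      (s(P X, P' X) : Sym2 V) = s(a, b) ∧ (s(P Y, P' Y) : Sym2 V) = s(a, c) ∧ (s(P Z, P' Z) : Sym2 V) = s(b, c) ∧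
      T = {X, Y, Z} with htri
  set rsh : Finset ι → Prop := fun T => ∃ (M E₁ E₂ : ι) (q₁ q₂ f₁ f₂ : V),
      M ∉ F ∧ (s(P M, P' M) : Sym2 V) = s(q₁, q₂) ∧ (s(P E₁, P' E₁) : Sym2 V) = s(q₁, f₁) ∧
      (s(P E₂, P' E₂) : Sym2 V) = s(q₂, f₂) ∧ q₁ ≠ q₂ ∧ f₁ ≠ q₁ ∧ f₁ ≠ q₂ ∧ f₂ ≠ q₁ ∧ f₂ ≠ q₂ ∧
      q₁ ≠ r ∧ q₂ ≠ r ∧ f₁ ≠ r ∧ f₂ ≠ r ∧ T = {M, E₁, E₂} with hrsh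
  haveI htriDec : DecidablePred tri := fun _ => Classical.propDecidable _
  haveI hrshDec : DecidablePred rsh := fun _ => Classical.propDecidable _
  set TRIS : Finset (Finset ι) := (univ : Finset ι).powerset.filter tri with hTRISdef
  set REGT : Finset (Finset ι) := (univ : Finset ι).powerset.filter rsh with hREGTdef
  have hTRIS : ∀ T, T ∈ TRIS ↔ tri T := fun T => by
    rw [hTRISdef, mem_filter]
    exact ⟨fun h => h.2, fun h => ⟨mem_powerset.2 (subset_univ _), h⟩⟩
  have hREGT : ∀ T, T ∈ REGT ↔ rsh T := fun T => by
    rw [hREGTdef, mem_filter]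
    exact ⟨fun h => h.2, fun h => ⟨mem_powerset.2 (subset_univ _), h⟩⟩
  -- the set of charged units of the TARGET and its two halves
  set U_all := (univ : Finset (Finset ι × ι)).filter (fun u => u.2 ∈
        (if ((∀ I ∈ F, I ∉ u.1) ∨ ∃ a ∈ F, P a = r ∧ a ∈ u.1 ∧ ∀ b ∈ F, b < a → b ∉ u.1) then
          (u.1.filter (fun X => X ∈ (univ \ F).filter (fun κ => P κ ≠ r ∧ P' κ ≠ r) ∧
            ∀ Y ∈ u.1, (P Y = P X ∨ P Y = P' X ∨ P' Y = P X ∨ P' Y = P' X))).erase (free u.1)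
         else
          u.1.filter (fun X => X ∈ (univ \ F).filter (fun κ => P κ ≠ r ∧ P' κ ≠ r) ∧
            ∀ Y ∈ u.1, (P Y = P X ∨ P Y = P' X ∨ P' Y = P X ∨ P' Y = P' X)))) with hU_all
  have hmemIf : ∀ (c : Prop) (hc : Decidable c) (A : Finset ι) (f x : ι),
      x ∈ (@ite _ c hc (A.erase f) A) ↔ x ∈ A ∧ (c → x ≠ f) := by
    intro c hc A f x
    by_cases h : c
    · rw [if_pos h, mem_erase]
      exact ⟨fun h' => ⟨h'.2, fun _ => h'.1⟩, fun h' => ⟨h'.2 h, h'.1⟩⟩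
    · rw [if_neg h]
      exact ⟨fun h' => ⟨h', fun h'' => absurd h'' h⟩, fun h' => h'.1⟩
  have hUiff : ∀ u, u ∈ U_all ↔ u.2 ∈ Ω u.1 ∧ (y1 u.1 → u.2 ≠ free u.1) := by
    intro u
    rw [hU_all, mem_filter]
    simp only [mem_univ, true_and]
    exact hmemIf (y1 u.1) _ (Ω u.1) (free u.1) u.2
  set early : Finset ι × ι → Prop := fun u =>
    (∃ a b c : V, a ≠ b ∧ a ≠ c ∧ b ≠ c ∧ a ≠ r ∧ b ≠ r ∧ c ≠ r ∧
        (∃ X ∈ u.1, (s(P X, P' X) : Sym2 V) = s(a, b)) ∧ (∃ Y ∈ u.1, (s(P Y, P' Y) : Sym2 V) = s(a, c)) ∧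
          ∃ Z ∈ u.1, (s(P Z, P' Z) : Sym2 V) = s(b, c)) ∨
    (∃ Y ∈ u.1, Y ≠ u.2 ∧ P Y ≠ r ∧ P' Y ≠ r ∧
        ((∃ p, (P u.2 = p ∨ P' u.2 = p) ∧ P Y ≠ p ∧ P' Y ≠ p ∧ P (dom u.2 p) ≠ r ∧ P' (dom u.2 p) ≠ r) ∨
         (Y ∉ F ∧ ∃ s', (P Y = s' ∨ P' Y = s') ∧ P u.2 ≠ s' ∧ P' u.2 ≠ s' ∧ P (dom Y s') ≠ r ∧ P' (dom Y s') ≠ r))) ∨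
    (∃ d, (P u.2 = d ∨ P' u.2 = d) ∧ P (dom u.2 d) = r ∧ (∃ Y ∈ u.1, P Y ≠ d ∧ P' Y ≠ d) ∧
        cred (insert (dom u.2 d) (u.1.erase u.2))) with hearly
  haveI hearlyDec : DecidablePred early := fun _ => Classical.propDecidable _
  set Ue := U_all.filter early with hUe
  set Ur := U_all.filter (fun u => ¬ early u) with hUr
  have hsplit : ∑ u ∈ U_all, W u.1 = ∑ u ∈ Ue, W u.1 + ∑ u ∈ Ur, W u.1 :=
    (sum_filter_add_sum_filter_not U_all early _).symm
  -- the early bound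
  have hE := early_bound P P' hPP' hinj r F hforest θ hθ0 hθ1 O hO0 Φ hO2 hΦ4 hΦsq dom hdom W (fun S => rfl) C (fun T => rfl)
    Ω (fun S => rfl) cred (fun S => Iff.rfl) free hfree' TRIS
    (fun a b c X Y Z hab hac hbc har hbr hcr hX hY hZ => (hTRIS _).2 ⟨a, b, c, X, Y, Z, hab, hac, hbc, har, hbr, hcr, hX, hY, hZ, rfl⟩)
    REGT (fun T hT => (hREGT T).2 hT) Ue (fun u hu => by
      obtain ⟨hu1, hu2⟩ := mem_filter.1 hu
      obtain ⟨hΩu, hch⟩ := (hUiff u).1 hu1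
      exact ⟨hΩu, hch, hu2⟩)
  -- the residual bound
  have hRes := hR W (fun S => rfl) C (fun T => rfl) Ω (fun S => rfl) cred (fun S => Iff.rfl) free hfree' hfreeq' TRIS hTRIS REGT hREGT
    Ur (fun u hu => by
      obtain ⟨hu1, hu2⟩ := mem_filter.1 hu
      obtain ⟨hΩu, hch⟩ := (hUiff u).1 hu1
      simp only [hearly, not_or] at hu2
      exact ⟨hΩu, hch, hu2.1, hu2.2.1, hu2.2.2⟩)
  -- credits: non-pool credits + pool credits = all credits
  set CR := (univ : Finset ι).powerset.filter (fun S =>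
          S.filter (fun X => X ∈ (univ \ F).filter (fun κ => P κ ≠ r ∧ P' κ ≠ r) ∧
            ∀ Y ∈ S, (P Y = P X ∨ P Y = P' X ∨ P' Y = P X ∨ P' Y = P' X)) = ∅ ∧
          ((∀ I ∈ F, I ∉ S) ∨ ∃ a ∈ F, P a = r ∧ a ∈ S ∧ ∀ b ∈ F, b < a → b ∉ S)) with hCR
  have hCRmem : ∀ S, S ∈ CR ↔ cred S := fun S => by
    rw [hCR, mem_filter]
    exact ⟨fun h => h.2, fun h => ⟨mem_powerset.2 (subset_univ _), h⟩⟩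
  have hcr1 : ∀ inst, @Finset.filter (Finset ι) (fun S => cred S ∧ ∃ K ∈ S, ¬ ((K ∉ F ∧ (P K = r ∨ P' K = r)) ∨ (K ∈ F ∧ P K = r)))
      inst (univ : Finset ι).powerset = CR.filter (fun S => ¬ ∀ K ∈ S, pool K) := by
    intro inst
    ext S
    simp only [mem_filter, hCRmem, mem_powerset]
    constructor
    · rintro ⟨-, hc, K, hK, hnp⟩
      exact ⟨hc, fun h => hnp (h K hK)⟩
    · rintro ⟨hc, h⟩
      obtain ⟨K, hK, hnp⟩ : ∃ K ∈ S, ¬ pool K := by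
        by_contra hne
        exact h fun K hK => by_contra fun hK' => hne ⟨K, hK, hK'⟩
      exact ⟨subset_univ _, hc, K, hK, hnp⟩
  have hcr2 : ∀ inst, @Finset.filter (Finset ι) (fun S => cred S ∧
        ∀ K ∈ S, (K ∉ F ∧ (P K = r ∨ P' K = r)) ∨ (K ∈ F ∧ P K = r)) inst (univ : Finset ι).powerset =
      CR.filter (fun S => ∀ K ∈ S, pool K) := by
    intro inst
    ext S
    simp only [mem_filter, hCRmem, mem_powerset]
    exact ⟨fun h => ⟨h.2.1, h.2.2⟩, fun h => ⟨subset_univ _, h.1, h.2⟩⟩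
  rw [hcr1] at hE
  rw [hcr2] at hRes
  have hcredits : ∑ S ∈ CR.filter (fun S => ¬ ∀ K ∈ S, pool K), W S + ∑ S ∈ CR.filter (fun S => ∀ K ∈ S, pool K), W S =
      ∑ S ∈ CR, W S := by
    rw [add_comm]
    exact sum_filter_add_sum_filter_not CR (fun S => ∀ K ∈ S, pool K) _
  -- words: per class-set the coefficients add up to at most one
  have hwords : (51 / 128) * ∑ T ∈ TRIS, C T + (1 / 2) * ∑ T ∈ REGT, C T +
      (∑ T ∈ (univ : Finset ι).powerset.filter (fun T => T ∉ TRIS ∧ T ∉ REGT), C T + (13 / 128) * ∑ T ∈ REGT, C T) ≤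
      ∑ T ∈ (univ : Finset ι).powerset, C T := by
    have h3 : ∑ T ∈ (univ : Finset ι).powerset.filter (fun T => T ∉ TRIS ∧ T ∉ REGT), C T =
        ∑ T ∈ (univ : Finset ι).powerset, (if (¬ tri T ∧ ¬ rsh T) then C T else 0) := by
      rw [sum_filter]
      refine sum_congr rfl fun T _ => if_congr ?_ rfl rfl
      rw [hTRIS, hREGT]
    rw [hTRISdef, hREGTdef, sum_filter, sum_filter, h3]
    have hpt : ∀ T ∈ (univ : Finset ι).powerset,
        (51 / 128) * (if tri T then C T else 0) + (1 / 2) * (if rsh T then C T else 0) +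
          ((if (¬ tri T ∧ ¬ rsh T) then C T else 0) + (13 / 128) * (if rsh T then C T else 0)) ≤ C T := by
      intro T _
      have hCT := hC0 T
      by_cases h1 : tri T
      · by_cases h2 : rsh T
        · rw [if_pos h1, if_pos h2, if_neg (fun h => h.1 h1)]; linarith
        · rw [if_pos h1, if_neg h2, if_neg (fun h => h.1 h1)]; linarith
      · by_cases h2 : rsh T
        · rw [if_neg h1, if_pos h2, if_neg (fun h => h.2 h2)]; linarith
        · rw [if_neg h1, if_neg h2, if_pos ⟨h1, h2⟩]; linarith
    calc (51 / 128) * ∑ T ∈ (univ : Finset ι).powerset, (if tri T then C T else 0) +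
          (1 / 2) * ∑ T ∈ (univ : Finset ι).powerset, (if rsh T then C T else 0) +
          (∑ T ∈ (univ : Finset ι).powerset, (if (¬ tri T ∧ ¬ rsh T) then C T else 0) +
            (13 / 128) * ∑ T ∈ (univ : Finset ι).powerset, (if rsh T then C T else 0))
        = ∑ T ∈ (univ : Finset ι).powerset, ((51 / 128) * (if tri T then C T else 0) + (1 / 2) * (if rsh T then C T else 0) +
            ((if (¬ tri T ∧ ¬ rsh T) then C T else 0) + (13 / 128) * (if rsh T then C T else 0))) := by
          rw [mul_sum, mul_sum, mul_sum, ← sum_add_distrib, ← sum_add_distrib, ← sum_add_distrib]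
      _ ≤ ∑ T ∈ (univ : Finset ι).powerset, C T := sum_le_sum hpt
  -- assemble
  have hgoalW : ∑ u ∈ U_all, ((∏ k ∈ u.1, θ k) * ∏ k ∈ univ \ u.1, (1 - θ k)) = ∑ u ∈ U_all, W u.1 := rfl
  have hgoalCR : ∑ S ∈ CR, ((∏ k ∈ S, θ k) * ∏ k ∈ univ \ S, (1 - θ k)) = ∑ S ∈ CR, W S := rfl
  have hgoalB : ∑ T ∈ (univ : Finset ι).powerset,
        ∑ δ ∈ (univ : Finset (ι → Bool)).filter (fun δ => (∀ X ∉ T, δ X = false) ∧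
            3 ≤ (T.image fun X => if δ X then P X else P' X).card ∧ r ∉ T.image fun X => if δ X then P X else P' X),
          ∏ X ∈ T, O X (if δ X then P X else P' X) = ∑ T ∈ (univ : Finset ι).powerset, C T := rfl
  rw [hgoalW, hgoalCR, hgoalB, hsplit, ← hcredits]
  linarith [hE, hRes, hwords]

end StarSet

end Summit.CriticalPhenomena.PercolationContinuityZ3.Theorems
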